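import Mathlib.Tactic
import HarnessLib
import HarnessLib.Audit.Tags
import Summits.CriticalPhenomena.PercolationContinuityZ3.Theorems.PercNearOneGluingNoHeavyLowerTailSahiAntichainSplitSix
import Summits.CriticalPhenomena.PercolationContinuityZ3.Theorems.PercNearOneGluingNoHeavyLowerTailSahiAntichainSplitTwoTwo

/-!
# Antichains, meets plus joins: four members have seven labels; V5 unconditionally for at most seven members

Support file (seat `prim-masterthm-p1`, gen 36; `--supports stmt-CriticalPhenomena-4575`).  No `sorry`, no new definitions, standard
axioms.  Memo `run/shared/lean/prim/prim-masterthm/FROM-prim-masterthm-p1-g36-DUALITY-PROJECTION-SUNFLOWER.md` §7.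

SETTING (files `…SahiAntichainSplit*`): V5 says an antichain has `2 #P ≤ #meets P + #joins P + 2`; `…SplitSix` proved it for
`#P ≤ 6`.  For `#P = 7` a point can split `3 + 4`; a three-member side that is a (co)sunflower is a good point, otherwise it has
`#meets + #joins ≥ 5`, and the four-member side must then contribute `7` — one more than V5 gives.

NEW HERE ([this work], gen 36).
* `three_le_newLabels_of_one_sunflower` / `…_of_one_cosunflower`: one member above `r` and a three-petal (co)sunflower below `r`
  ⟹ `newLabels ≥ 3` (all cross joins are new; if two coincide, two cross meets contain the two exchanged petals and are new).
* `seven_le_of_card_eq_four`: **every four-member antichain has `#meets + #joins ≥ 7`** (no four-member antichain is V5-tight): at an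
  effective point the split is `1 + 3` (trichotomy of the three-side plus the two lemmas above), `2 + 2` (`three_le_newLabels_of_two_two`
  of `…SplitTwoTwo`) or `3 + 1` (complement duality `…SahiAntichainDual` reduces it to `1 + 3`).
* `two_mul_card_le_of_card_le_seven`: **V5 for every antichain with at most seven members**, unconditionally: the only new split is
  `3 + 4`, where a (co)sunflower three-side is a good point (`…SplitSunflower`, `…SplitCosunflower`) and otherwise `5 + 7 ≥ 12` pays
  without any new label.  V1 for `#P ≤ 7` follows.
HONEST FRAMING: V5 for `#P ≥ 8` remains OPEN (the `3 + 5` split would need «five members ⟹ nine labels»). [this work]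
-/

namespace Summit.CriticalPhenomena.PercolationContinuityZ3.Theorems.SahiColouredDaykin

open Finset

variable {α : Type*} [DecidableEq α]

/-! ### 1. One member above, a three-petal (co)sunflower below -/

section OneThree

variable {P : Finset (Finset α)} {r : α}

/-- With a single member above `r`, every cross join is new. [this work] -/
theorem union_mem_newJoins_of_card_above_eq_one (h1 : #(above P r) = 1) {a b : Finset α} (ha : a ∈ above P r)
    (hb : b ∈ below P r) : a ∪ b ∈ newJoins P r := by
  rw [union_mem_newJoins_iff ha hb, joins_eq_empty_of_card_le_one (by omega)]
  exact notMem_empty _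

/-- A point of `b \ b'` lies in `a` when `a ∪ b = a ∪ b'`. [this work] -/
theorem mem_of_union_eq {a b b' : Finset α} (h : a ∪ b = a ∪ b') {t : α} (htb : t ∈ b) (htb' : t ∉ b') : t ∈ a := by
  have : t ∈ a ∪ b' := by rw [← h]; exact mem_union_right _ htb
  rcases mem_union.1 this with h' | h'
  · exact h'
  · exact absurd h' htb'

/-- **One above, sunflower below.**  `above P r = {a}` and `below P r` a sunflower with three petals ⟹ `newLabels ≥ 3`. [this work] -/
theorem three_le_newLabels_of_one_sunflower {K : Finset α} (hanti : IsAntichain (· ⊆ ·) (P : Set (Finset α)))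
    (h1 : #(above P r) = 1) (h3 : 3 ≤ #(below P r))
    (hK : ∀ b ∈ below P r, ∀ b' ∈ below P r, b ≠ b' → b ∩ b' = K) : 3 ≤ newLabels P r := by
  obtain ⟨a, haA⟩ := card_eq_one.1 h1
  have ha : a ∈ above P r := by rw [haA]; exact mem_singleton_self a
  obtain ⟨b₁, hb₁, b₂, hb₂, b₃, hb₃, h12, h13, h23⟩ := two_lt_card.1 (by omega : 2 < #(below P r))
  have hMK : ∀ {Z : Finset α}, Z ∈ meets (below P r) → Z = K := by
    intro Z hZ
    obtain ⟨e, he, e', he', hee', rfl⟩ := mem_meets_iff.1 hZ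
    exact hK e he e' he' hee'
  -- if two cross joins coincide, two cross meets are new
  have key : ∀ {b b' : Finset α}, b ∈ below P r → b' ∈ below P r → b ≠ b' → a ∪ b = a ∪ b' → 3 ≤ newLabels P r := by
    intro b b' hb hb' hbb' hu
    obtain ⟨hbP, _⟩ := mem_below_iff.1 hb
    obtain ⟨hb'P, _⟩ := mem_below_iff.1 hb'
    obtain ⟨w, hwb, hwb'⟩ := not_subset.1 (hanti (mem_coe.2 hbP) (mem_coe.2 hb'P) hbb')
    obtain ⟨w', hw'b', hw'b⟩ := not_subset.1 (hanti (mem_coe.2 hb'P) (mem_coe.2 hbP) hbb'.symm)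
    have hwa : w ∈ a := mem_of_union_eq hu hwb hwb'
    have hw'a : w' ∈ a := mem_of_union_eq hu.symm hw'b' hw'b
    have hwK : w ∉ K := by rw [← hK b hb b' hb' hbb']; exact fun h => hwb' (mem_inter.1 h).2
    have hw'K : w' ∉ K := by rw [← hK b hb b' hb' hbb']; exact fun h => hw'b (mem_inter.1 h).1
    have n1 : a ∩ b ∈ newMeets P r := by
      rw [inter_mem_newMeets_iff ha hb]; intro hold
      exact hwK (hMK hold ▸ mem_inter.2 ⟨hwa, hwb⟩)
    have n2 : a ∩ b' ∈ newMeets P r := by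
      rw [inter_mem_newMeets_iff ha hb']; intro hold
      exact hw'K (hMK hold ▸ mem_inter.2 ⟨hw'a, hw'b'⟩)
    have n12 : a ∩ b ≠ a ∩ b' := by
      intro h; have : w ∈ a ∩ b' := h ▸ mem_inter.2 ⟨hwa, hwb⟩; exact hwb' (mem_inter.1 this).2
    have := card_add_card_le_newLabels (S := {a ∩ b, a ∩ b'}) (T := {a ∪ b})
      (by intro Z hZ; rcases mem_insert.1 hZ with rfl | hZ; exact n1; rw [mem_singleton.1 hZ]; exact n2)
      (by intro W hW; rw [mem_singleton.1 hW]; exact union_mem_newJoins_of_card_above_eq_one h1 ha hb)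
    rw [card_pair n12, card_singleton] at this; omega
  by_cases e12 : a ∪ b₁ = a ∪ b₂
  · exact key hb₁ hb₂ h12 e12
  by_cases e13 : a ∪ b₁ = a ∪ b₃
  · exact key hb₁ hb₃ h13 e13
  by_cases e23 : a ∪ b₂ = a ∪ b₃
  · exact key hb₂ hb₃ h23 e23
  -- three distinct new joins
  have := card_add_card_le_newLabels (S := ∅) (T := {a ∪ b₁, a ∪ b₂, a ∪ b₃}) (empty_subset _)
    (by
      intro W hW
      rcases mem_insert.1 hW with rfl | hW; exact union_mem_newJoins_of_card_above_eq_one h1 ha hb₁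
      rcases mem_insert.1 hW with rfl | hW; exact union_mem_newJoins_of_card_above_eq_one h1 ha hb₂
      rw [mem_singleton.1 hW]; exact union_mem_newJoins_of_card_above_eq_one h1 ha hb₃)
  rw [card_eq_three.2 ⟨_, _, _, e12, e13, e23, rfl⟩, card_empty] at this; omega

/-- **One above, co-sunflower below** (three members below with all pairwise unions equal) ⟹ `newLabels ≥ 3`. [this work] -/
theorem three_le_newLabels_of_one_cosunflower {U : Finset α} (hanti : IsAntichain (· ⊆ ·) (P : Set (Finset α)))
    (h1 : #(above P r) = 1) (hB3 : #(below P r) = 3)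
    (hU : ∀ b ∈ below P r, ∀ b' ∈ below P r, b ≠ b' → b ∪ b' = U) : 3 ≤ newLabels P r := by
  obtain ⟨a, haA⟩ := card_eq_one.1 h1
  have ha : a ∈ above P r := by rw [haA]; exact mem_singleton_self a
  obtain ⟨haP, hra⟩ := mem_above_iff.1 ha
  obtain ⟨b₁, b₂, b₃, h12, h13, h23, hBeq⟩ := card_eq_three.1 hB3
  have hb₁ : b₁ ∈ below P r := by rw [hBeq]; simp
  have hb₂ : b₂ ∈ below P r := by rw [hBeq]; simp
  have hb₃ : b₃ ∈ below P r := by rw [hBeq]; simp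
  have hcases : ∀ e ∈ below P r, e = b₁ ∨ e = b₂ ∨ e = b₃ := by
    intro e he; rw [hBeq] at he; simpa only [mem_insert, mem_singleton] using he
  have nJ : ∀ {b : Finset α}, b ∈ below P r → a ∪ b ∈ newJoins P r :=
    fun hb => union_mem_newJoins_of_card_above_eq_one h1 ha hb
  -- all three cross joins equal: three distinct new meets (the one-sided mechanism)
  have allEq : a ∪ b₁ = a ∪ b₂ → a ∪ b₁ = a ∪ b₃ → 3 ≤ newLabels P r := by
    intro e12 e13
    have hconst : ∀ e ∈ below P r, a ∪ e = a ∪ b₁ := by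
      intro e he; rcases hcases e he with rfl | rfl | rfl; rfl; exact e12.symm; exact e13.symm
    have nM : ∀ {b : Finset α}, b ∈ below P r → a ∩ b ∈ newMeets P r := by
      intro b hb
      obtain ⟨hbP, hrb⟩ := mem_below_iff.1 hb
      rw [inter_mem_newMeets_iff ha hb]
      intro hold
      obtain ⟨e, he, e', he', _, heq⟩ := mem_meets_iff.1 hold
      have hba : b ⊆ a := by
        intro t htb
        by_contra hta
        have h1' : t ∈ e := by
          have : t ∈ a ∪ e := by rw [hconst e he, ← hconst b hb]; exact mem_union_right _ htb
          rcases mem_union.1 this with h' | h'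
          · exact absurd h' hta
          · exact h'
        have h2' : t ∈ e' := by
          have : t ∈ a ∪ e' := by rw [hconst e' he', ← hconst b hb]; exact mem_union_right _ htb
          rcases mem_union.1 this with h' | h'
          · exact absurd h' hta
          · exact h'
        have : t ∈ a ∩ b := by rw [heq]; exact mem_inter.2 ⟨h1', h2'⟩
        exact hta (mem_inter.1 this).1
      exact hanti (mem_coe.2 hbP) (mem_coe.2 haP) (by rintro rfl; exact hrb hra) hba
    have d : ∀ {b b' : Finset α}, b ∈ below P r → b' ∈ below P r → b ≠ b' → a ∩ b ≠ a ∩ b' := by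
      intro b b' hb hb' hbb' h
      exact hbb' (eq_of_inter_eq_of_union_eq h ((hconst b hb).trans (hconst b' hb').symm))
    have := card_add_card_le_newLabels (S := {a ∩ b₁, a ∩ b₂, a ∩ b₃}) (T := ∅)
      (by
        intro Z hZ
        rcases mem_insert.1 hZ with rfl | hZ; exact nM hb₁
        rcases mem_insert.1 hZ with rfl | hZ; exact nM hb₂
        rw [mem_singleton.1 hZ]; exact nM hb₃)
      (empty_subset _)
    rw [card_eq_three.2 ⟨_, _, _, d hb₁ hb₂ h12, d hb₁ hb₃ h13, d hb₂ hb₃ h23, rfl⟩, card_empty] at this; omega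
  -- exactly two cross joins coincide: two distinct new joins and a new meet
  have key : ∀ {b b' b'' : Finset α}, b ∈ below P r → b' ∈ below P r → b'' ∈ below P r → b ≠ b' → b ≠ b'' → b' ≠ b'' →
      (∀ e ∈ below P r, e = b ∨ e = b' ∨ e = b'') → a ∪ b = a ∪ b' → a ∪ b ≠ a ∪ b'' → 3 ≤ newLabels P r := by
    intro b b' b'' hb hb' hb'' hbb' hbb'' hb'b'' hcs hu hne
    obtain ⟨hbP, _⟩ := mem_below_iff.1 hb
    obtain ⟨hb'P, _⟩ := mem_below_iff.1 hb'
    obtain ⟨hb''P, hrb''⟩ := mem_below_iff.1 hb''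
    obtain ⟨w, hwb, hwb'⟩ := not_subset.1 (hanti (mem_coe.2 hbP) (mem_coe.2 hb'P) hbb')
    obtain ⟨w', hw'b', hw'b⟩ := not_subset.1 (hanti (mem_coe.2 hb'P) (mem_coe.2 hbP) hbb'.symm)
    have hwa : w ∈ a := mem_of_union_eq hu hwb hwb'
    have hw'a : w' ∈ a := mem_of_union_eq hu.symm hw'b' hw'b
    have n12 : a ∩ b ≠ a ∩ b' := by
      intro h; have : w ∈ a ∩ b' := h ▸ mem_inter.2 ⟨hwa, hwb⟩; exact hwb' (mem_inter.1 this).2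
    -- an old cross meet through b (resp. b') forces `b ∩ b'' ⊆ a` (resp. `b' ∩ b'' ⊆ a`)
    have old1 : a ∩ b ∈ meets (below P r) → b ∩ b'' ⊆ a := by
      intro hold
      obtain ⟨e, he, e', he', hee', heq⟩ := mem_meets_iff.1 hold
      have hwe : w ∈ e ∩ e' := heq ▸ mem_inter.2 ⟨hwa, hwb⟩
      have key2 : ∀ {g : Finset α}, g ∈ below P r → w ∈ g → g = b ∨ g = b'' := by
        intro g hg hwg
        rcases hcs g hg with h | h | h
        · exact Or.inl h
        · exact absurd (h ▸ hwg) hwb'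
        · exact Or.inr h
      rcases key2 he (mem_inter.1 hwe).1 with rfl | rfl <;> rcases key2 he' (mem_inter.1 hwe).2 with h' | h'
      · exact absurd h'.symm hee'
      · subst h'; rw [← heq]; exact inter_subset_left
      · subst h'; rw [inter_comm, ← heq]; exact inter_subset_left
      · exact absurd h'.symm hee'
    have old2 : a ∩ b' ∈ meets (below P r) → b' ∩ b'' ⊆ a := by
      intro hold
      obtain ⟨e, he, e', he', hee', heq⟩ := mem_meets_iff.1 hold
      have hwe : w' ∈ e ∩ e' := heq ▸ mem_inter.2 ⟨hw'a, hw'b'⟩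
      have key2 : ∀ {g : Finset α}, g ∈ below P r → w' ∈ g → g = b' ∨ g = b'' := by
        intro g hg hwg
        rcases hcs g hg with h | h | h
        · exact absurd (h ▸ hwg) hw'b
        · exact Or.inl h
        · exact Or.inr h
      rcases key2 he (mem_inter.1 hwe).1 with rfl | rfl <;> rcases key2 he' (mem_inter.1 hwe).2 with h' | h'
      · exact absurd h'.symm hee'
      · subst h'; rw [← heq]; exact inter_subset_left
      · subst h'; rw [inter_comm, ← heq]; exact inter_subset_left
      · exact absurd h'.symm hee'
    -- not both old: otherwise b'' ⊆ a
    have oneNew : a ∩ b ∈ newMeets P r ∨ a ∩ b' ∈ newMeets P r := by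
      by_contra hboth
      push Not at hboth
      rw [inter_mem_newMeets_iff ha hb, inter_mem_newMeets_iff ha hb', not_not, not_not] at hboth
      have hsub : b'' ⊆ a := by
        intro t ht
        have htU : t ∈ b ∪ b' := by rw [hU b hb b' hb' hbb', ← hU b'' hb'' b hb hbb''.symm]; exact mem_union_left _ ht
        rcases mem_union.1 htU with h | h
        · exact old1 hboth.1 (mem_inter.2 ⟨h, ht⟩)
        · exact old2 hboth.2 (mem_inter.2 ⟨h, ht⟩)
      exact hanti (mem_coe.2 hb''P) (mem_coe.2 haP) (by rintro rfl; exact hrb'' hra) hsub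
    rcases oneNew with hZ | hZ
    all_goals
      have := card_add_card_le_newLabels (S := {_}) (T := {a ∪ b, a ∪ b''})
        (by intro Z hZ'; rw [mem_singleton.1 hZ']; exact hZ)
        (by intro W hW; rcases mem_insert.1 hW with rfl | hW; exact nJ hb; rw [mem_singleton.1 hW]; exact nJ hb'')
      rw [card_pair hne, card_singleton] at this; omega
  by_cases e12 : a ∪ b₁ = a ∪ b₂
  · by_cases e13 : a ∪ b₁ = a ∪ b₃
    · exact allEq e12 e13
    · exact key hb₁ hb₂ hb₃ h12 h13 h23 hcases e12 e13
  by_cases e13 : a ∪ b₁ = a ∪ b₃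
  · exact key hb₁ hb₃ hb₂ h13 h12 h23.symm (fun e he => by rcases hcases e he with h | h | h; exact Or.inl h; exact Or.inr (Or.inr h); exact Or.inr (Or.inl h)) e13 e12
  by_cases e23 : a ∪ b₂ = a ∪ b₃
  · exact key hb₂ hb₃ hb₁ h23 h12.symm h13.symm (fun e he => by rcases hcases e he with h | h | h; exact Or.inr (Or.inr h); exact Or.inl h; exact Or.inr (Or.inl h)) e23 (fun h => e12 h.symm)
  have := card_add_card_le_newLabels (S := ∅) (T := {a ∪ b₁, a ∪ b₂, a ∪ b₃}) (empty_subset _)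
    (by
      intro W hW
      rcases mem_insert.1 hW with rfl | hW; exact nJ hb₁
      rcases mem_insert.1 hW with rfl | hW; exact nJ hb₂
      rw [mem_singleton.1 hW]; exact nJ hb₃)
  rw [card_eq_three.2 ⟨_, _, _, e12, e13, e23, rfl⟩, card_empty] at this; omega

end OneThree

/-! ### 2. Four members have seven labels -/

/-- `1 + 3` splits of a four-member antichain give `#meets + #joins ≥ 7`. [this work] -/
theorem seven_le_of_one_three {P : Finset (Finset α)} {r : α} (hanti : IsAntichain (· ⊆ ·) (P : Set (Finset α)))
    (h1 : #(above P r) = 1) (h3 : #(below P r) = 3) : 7 ≤ #(meets P) + #(joins P) := by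
  have hsplit := card_meets_add_card_joins_split P r
  have hB := two_mul_card_le_of_card_le_three (below P r) (isAntichain_below hanti r) (by omega)
  have hP4 : #P = 4 := by have := card_above_add_card_below P r; omega
  rcases three_members_trichotomy (isAntichain_below hanti r) h3 with ⟨K, hK⟩ | ⟨U, hU⟩ | h5
  · have := three_le_newLabels_of_one_sunflower hanti h1 (by omega) hK; omega
  · have := three_le_newLabels_of_one_cosunflower hanti h1 h3 hU; omega
  · have := two_le_newLabels_of_card_above_eq_one hanti (by omega) h1; omega

/-- **Every four-member antichain has at least seven labels** (`#meets + #joins ≥ 7`). [this work] -/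
theorem seven_le_of_card_eq_four {P : Finset (Finset α)} (hanti : IsAntichain (· ⊆ ·) (P : Set (Finset α))) (h4 : #P = 4) :
    7 ≤ #(meets P) + #(joins P) := by
  obtain ⟨r, hr⟩ := effPoints_nonempty (by omega : 2 ≤ #P)
  obtain ⟨hA, hB⟩ := mem_effPoints_iff.1 hr
  have hcard := card_above_add_card_below P r
  have hApos : 0 < #(above P r) := card_pos.2 hA
  have hBpos : 0 < #(below P r) := card_pos.2 hB
  by_cases hA1 : #(above P r) = 1
  · exact seven_le_of_one_three hanti hA1 (by omega)
  by_cases hA2 : #(above P r) = 2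
  · -- the 2 + 2 split
    obtain ⟨a, a', haa, hAeq⟩ := card_eq_two.1 hA2
    obtain ⟨b, b', hbb, hBeq⟩ := card_eq_two.1 (by omega : #(below P r) = 2)
    have hsplit := card_meets_add_card_joins_split P r
    have h3 := three_le_newLabels_of_two_two hanti hAeq hBeq haa hbb
    have ihA := two_mul_card_le_of_card_le_three (above P r) (isAntichain_above hanti r) (by omega)
    have ihB := two_mul_card_le_of_card_le_three (below P r) (isAntichain_below hanti r) (by omega)
    omega
  · -- 3 + 1: complement duality
    have hA3 : #(above P r) = 3 := by omega
    set F := insert r (P.sup id) with hF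
    have hP : ∀ a ∈ P, a ⊆ F := subset_insert_sup P r
    have hrF : r ∈ F := mem_insert_self _ _
    rw [← card_meets_add_card_joins_image_compl hP]
    exact seven_le_of_one_three (isAntichain_image_compl hanti hP) (by rw [card_above_image_compl hP hrF]; omega)
      (by rw [card_below_image_compl hP hrF, hA3])

/-! ### 3. V5 for at most seven members -/

/-- **V5 holds unconditionally for antichains with at most seven members.** [this work] -/
theorem two_mul_card_le_of_card_le_seven :
    ∀ P : Finset (Finset α), IsAntichain (· ⊆ ·) (P : Set (Finset α)) → #P ≤ 7 → 2 * #P ≤ #(meets P) + #(joins P) + 2 := by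
  intro P hanti h7
  by_cases h6 : #P ≤ 6
  · exact two_mul_card_le_of_card_le_six P hanti h6
  have hP7 : #P = 7 := by omega
  obtain ⟨r, hr⟩ := effPoints_nonempty (by omega : 2 ≤ #P)
  obtain ⟨hA, hB⟩ := mem_effPoints_iff.1 hr
  have hcard := card_above_add_card_below P r
  have hApos : 0 < #(above P r) := card_pos.2 hA
  have hBpos : 0 < #(below P r) := card_pos.2 hB
  have ihA := two_mul_card_le_of_card_le_six (above P r) (isAntichain_above hanti r) (by omega)
  have ihB := two_mul_card_le_of_card_le_six (below P r) (isAntichain_below hanti r) (by omega)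
  by_cases hmin : #(above P r) ≤ 2 ∨ #(below P r) ≤ 2
  · exact two_mul_card_le_step P r (two_le_newLabels_of_min_le_two hanti hA hB hmin) ihA ihB
  push Not at hmin
  have hsplit := card_meets_add_card_joins_split P r
  by_cases hA3 : #(above P r) = 3
  · have hB4 : #(below P r) = 4 := by omega
    rcases three_members_trichotomy (isAntichain_above hanti r) hA3 with ⟨K, hK⟩ | ⟨U, hU⟩ | hA5
    · exact two_mul_card_le_step P r (two_le_newLabels_of_above_sunflower hanti (by omega) hB hK) ihA ihB
    · exact two_mul_card_le_step P r (two_le_newLabels_of_above_cosunflower hanti (by omega) hB hU) ihA ihB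
    · have h7' := seven_le_of_card_eq_four (isAntichain_below hanti r) hB4
      unfold newLabels at hsplit; omega
  · have hA4 : #(above P r) = 4 := by omega
    have hB3 : #(below P r) = 3 := by omega
    rcases three_members_trichotomy (isAntichain_below hanti r) hB3 with ⟨K, hK⟩ | ⟨U, hU⟩ | hB5
    · exact two_mul_card_le_step P r (two_le_newLabels_of_below_sunflower hanti (by omega) hA hK) ihA ihB
    · exact two_mul_card_le_step P r (two_le_newLabels_of_below_cosunflower hanti (by omega) hA hU) ihA ihB
    · have h7' := seven_le_of_card_eq_four (isAntichain_above hanti r) hA4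
      unfold newLabels at hsplit; omega

/-- V1 for at most seven members, unconditionally. [this work] -/
theorem card_le_or_card_le_of_card_le_seven (P : Finset (Finset α)) (hanti : IsAntichain (· ⊆ ·) (P : Set (Finset α)))
    (h7 : #P ≤ 7) : #P ≤ #(meets P) + 1 ∨ #P ≤ #(joins P) + 1 :=
  card_le_or_card_le_of_two_mul_card_le (two_mul_card_le_of_card_le_seven P hanti h7)

end Summit.CriticalPhenomena.PercolationContinuityZ3.Theorems.SahiColouredDaykin
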